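import Summits.BirchSwinnertonDyer.BirchSwinnertonDyer.Theorems.KimAtThreeDeepUpperAdditiveDefectOfFineKatoOnly
import HarnessLib

/-!
# Route `KimAtThreeKolyvagin` (rung W2), crux `DeepUpperAtThreeOffKatoStratum` (item 19562): the registered stub
# `stub_additiveDefect` VERBATIM, SPLIT BY LOCAL `3`-TORSION — `t = 0` rows on PRINTED [S24] (pinned engine),
# `E(ℚ₃)[3] ≠ 0` rows on the deep road — from the fine Kato package alone on each part

Cell `bsd-addord`, seat `bsd-addord-w2-acc1` gen 2 (PROGRAMME PART 1b, ACCEL-LIST l.753 row (1)), `--supports`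
stmt-BirchSwinnertonDyer-19562 (owner w2-c5 assembles via the registered
`Cruxes.DeepUpperAtThreeOffKatoStratum.Birth.DeepUpperAtThreeOffKatoStratum_of`).  Theorems only (no definition,
no named fact, no instance, no `sorry`); nothing asserted about any curve; the crux stays OPEN; BSD is not proved.

## Why the split (seat acc3's 19679 TorsionSplit pattern, UPPER side)

The companion ★ (`KimAtThreeDeepUpperAdditiveDefectOfFineKato.stub_additiveDefect_of_deepFacts_of_fineKatoTwoExp_of_certSupply`
with (C2) discharged by `…OfFineKatoOnly.certSupply_allDefectRows`) serves ALL THREE defect disjuncts through gen 1's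
DEEP-keyed engine, whose Kolyvagin data live in the class of depth `k + 2`; its price is the two S24-DEEP inputs
(flag `S24-DEEP-PORT@3`; since w2-c2 gen 5, p476788 / p477028, reduced to the PINNED [S24] facts + one good core
vertex, but still a displayed line).  On the `t = 0` defect rows (Kodaira IV/IV* `3 ∣ c₃`, `3 ∣ c_{D₀}`) that
price is unnecessary: seat acc3 gen 3's `KimAtThreeOffStratumAdditiveDefectOfFineKato.portTwoExp_rows_of_fineKato`
(acc6's ★₂′ re-keyed on w2-c3's `hbad`-free THEOREM D-u; (C2₂) a theorem) gives PORT₂ at `t = 0` from the fine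
Kato package (C1₂) ALONE, gen 1's `portEDeep_of_portTwoExp` turns it into pinned witnesses, and gen 1's PINNED
engine `deepUpper_datum_of_poitouTate_of_port_e` runs on the PRINTED facts [S24] Thm. 4.4 (1)(2).  So:

* ★ `stub_additiveDefect_of_torsionSplit : hS24 → hS24₂ → hS24d → hS24d₂ → hGZK → hPT → hPort₂⁰ → (C1ₜₑ)|_{t≠0}
  → ⟨REGISTERED stub VERBATIM⟩` — per row `by_cases #E(ℚ₃)[3] = 1`: YES ⟹ `hPort₂⁰` + gen 1 pinned engine on
  PRINTED [S24] (`hS24`/`hS24₂` = `Sakamoto2024.kolyvaginSystems_freeRankOne_zmod_three_pow` / `…idealOfBasis…`);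
  NO ⟹ the companion's deep road (`deepWitnessFamily_of_zetaBody_addv_of_valueRows`, (C2) by w2-c3's
  `certSupply_of_addv`, gen 1's `deepUpper_datum_of_poitouTate_of_port_e_deep` on S24-DEEP ×2).
* ★ `deepUpperAtThreeOffKatoStratum_of_wuthrich_of_torsionSplit` — crux 19562 BY NAME (the skeleton's case split
  on `Addv` with w2-c5's Wuthrich-road `stub_nonAdditive` + (DD) on the non-additive rows).
RESIDUAL OF RECORD for 19562's additive-defect rows after this file: `t = 0` rows ⟸ PRINTED [S24] ×2 + GZK + PT +
`hPort₂⁰` = (C1₂) by seat acc3's `portTwoExp_rows_of_fineKato` (seat acc6/acc3's fine Kato package in two-exponent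
form, `t := 0`, ONE `e` — the SAME displayed object as on 19599 / 19679; `hPort₂⁰` is displayed HERE only because
acc3's module was not yet built on the farm at submission time — the owner substitutes
`(KimAtThreeOffStratumAdditiveDefectOfFineKato.portTwoExp_rows_of_fineKato hC1₀)`); `E(ℚ₃)[3] ≠ 0` rows ⟸
S24-DEEP ×2 + GZK + PT + (C1ₜₑ) (the companion's shape, `∃ t e`).  No `ht0`, no bad-place certificate, no
(C2)/(C3), no (DD)/(U′), no Manin / period / `c₃` hypothesis.
References: [Kato2004Asterisque] (8.1.3), §9.4, Thm. 9.7, Thm. 6.6 (1), Ex. 13.3; [Kim2022StructureSelmer] Thm. 3.13,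
Rem. 3.8, §2.2.2, §3.2.3; [Kim2025RefinedTNC] Thm 1.1, §4.2, §8.1.2; [MazurRubin2004] Thm. 3.2.4, App. A
(Lemma A.1, Prop. A.2); [Sakamoto2024] Thm. 4.4 (1)(2) (p. 926); [Wuthrich2014] Prop. 21; [MilneADT2006] I.4.10;
[Manin1972] Prop. 1.4, Thm. 1.6; [TateGCFT1967] §2.4.
-/

set_option autoImplicit false
-- the Theorems namespace of a single-conjunct summit repeats the summit name by design (D-0017)
set_option linter.dupNamespace false

noncomputable section

open scoped NumberField TensorProduct ContRepresentation Classical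
open CategoryTheory Field Function Finset IsDedekindDomain NumberField WeierstrassCurve
open Rat.HeightOneSpectrum
open Literature.NumberTheory.GaloisRepresentations Literature.NumberTheory.GaloisCohomology
open Literature.NumberTheory.GaloisRepresentations.DiscreteGaloisModule
open Literature.NumberTheory.EllipticCurves Literature.NumberTheory.EllipticCurves.ModularForms
open Literature.NumberTheory.EllipticCurves.Rank1Residual
open Literature.NumberTheory.EllipticCurves.Kato2004
open Literature.NumberTheory.EllipticCurves.Kato2004.EulerSystemValues
open Summit.BirchSwinnertonDyer.Rank1Residual.GaloisImage
open Summit.BirchSwinnertonDyer.BirchSwinnertonDyer.Theses.KimAtThreeKolyvagin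
open Summit.BirchSwinnertonDyer.BirchSwinnertonDyer.Theorems.KimAtThreeKolyvaginDefs
open Summit.BirchSwinnertonDyer.BirchSwinnertonDyer.Theorems.KimAtThreeDeepUpperAdditiveDefectOfFineKato
open Summit.BirchSwinnertonDyer.BirchSwinnertonDyer.Theorems.KimAtThreeDeepUpperAdditiveDefectOfPortE
open Summit.BirchSwinnertonDyer.BirchSwinnertonDyer.Theorems.KimAtThreeDeepUpperAdditiveDefectOfPortEDeep
open Summit.BirchSwinnertonDyer.BirchSwinnertonDyer.Theorems.KimAtThreeDeepUpperOffStratumOfPortFamily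
open Summit.BirchSwinnertonDyer.BirchSwinnertonDyer.Theorems.KimAtThreeDeepUpperOffStratumWuthrich
open Summit.BirchSwinnertonDyer.BirchSwinnertonDyer.Theorems.KimAtThreeDeepUpperCertSupplyDefect
open Summit.BirchSwinnertonDyer.BirchSwinnertonDyer.Theorems.KimAtThreeShallowEqDeepSplitGlueNoStub

namespace Summit.BirchSwinnertonDyer.BirchSwinnertonDyer.Theorems.KimAtThreeDeepUpperAdditiveDefectTorsionSplit

/-- Local notation: the TWO-EXPONENT rider clause (ii₂) at depth `j`, torsion exponent `t`, defect exponent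
`e`, place `v`, for the pair `(Λ, Λf)` — seat acc6's spelling. -/
local notation3 (prettyPrint := false) "RIDER₂⟦" W' ", " j ", " t' ", " e' ", " v' ", " Λ' ", " Λf "⟧" =>
  ∀ (r : Finset (HeightOneSpectrum (𝓞 ℚ)))
    (Ψ : H1 (tateRep W' 3) (cycSubgroup 3 0 r) →+
      continuousCohomology 1
        (subgroupRep (WeierstrassCurve.torsionGaloisModule W' (((3 : ℕ) : ℤ) ^ j * ((3 : ℕ) : ℤ))).toTopRep
          (cycSubgroup 3 0 r))),
    (∀ (φ : contOneCocycles (subgroupRep (tateRep W' 3).toTopRep (cycSubgroup 3 0 r)))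
        (ψ : contOneCocycles
          (subgroupRep (WeierstrassCurve.torsionGaloisModule W' (((3 : ℕ) : ℤ) ^ j * ((3 : ℕ) : ℤ))).toTopRep
            (cycSubgroup 3 0 r))),
        (∀ g, ((ψ.1 g : geomTorsion W' (((3 : ℕ) : ℤ) ^ j * ((3 : ℕ) : ℤ))) : geomPoints W') =
          TateModule.proj 3 (j + 1) (φ.1 g)) →
        Ψ (oneCocycleClass _ φ) = oneCocycleClass _ ψ) →
    ∀ (y : H1 (tateRep W' 3) (cycSubgroup 3 0 r))
      (κ₀ : galoisCohomology (WeierstrassCurve.torsionGaloisModule W' (((3 : ℕ) : ℤ) ^ j * ((3 : ℕ) : ℤ))) 1)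
      (s : ℤ_[3]),
      resSubgroup (WeierstrassCurve.torsionGaloisModule W' (((3 : ℕ) : ℤ) ^ j * ((3 : ℕ) : ℤ))).toTopRep
          (cycSubgroup 3 0 r) 1 κ₀ = Ψ y →
      galoisCohomology.localization (WeierstrassCurve.torsionGaloisModule W' (((3 : ℕ) : ℤ) ^ j * ((3 : ℕ) : ℤ)))
          (Sum.inr v') 1 κ₀ ∈ propagatedSelmerStructure W' 3 j (Sum.inr v') →
      (∃ l ∈ cycIntLattice 3 (cycLevel 3 0 r),
          (((3 : ℕ) : ℤ_[3]) ^ t') • Λ' 0 r y - ((s : ℚ_[3]) ⊗ₜ[ℚ] (1 : CyclotomicField (cycLevel 3 0 r) ℚ)) =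
            (((3 : ℕ) : ℤ_[3]) ^ (j + 1)) • (l : ℚ_[3] ⊗[ℚ] CyclotomicField (cycLevel 3 0 r) ℚ)) →
      ((3 ^ e' : ℕ) : ZMod (3 ^ (j + 1))) *
        Λf (galoisCohomology.localization
          (WeierstrassCurve.torsionGaloisModule W' (((3 : ℕ) : ℤ) ^ j * ((3 : ℕ) : ℤ))) (Sum.inr v') 1 κ₀) =
        PadicInt.toZModPow (j + 1) s

/-- Local notation: **`hPort₂⁰` — PORT₂ at `t = 0` on the `t = 0` additive-defect rows** (seat acc6 gen 0's /
acc3's binder `PORT₂ROWS⁰` VERBATIM; DISCHARGED from the fine Kato package (C1₂) alone by seat acc3 gen 3's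
`KimAtThreeOffStratumAdditiveDefectOfFineKato.portTwoExp_rows_of_fineKato` — a one-term application for the owner). -/
local notation3 (prettyPrint := false) "PORT₂ROWS⁰" =>
  ∀ (W : WeierstrassCurve ℚ) [W.IsElliptic] [W.IsGloballyMinimal],
    (∀ m : ℕ, W.HasSurjectiveModNGaloisRep (3 ^ m : ℕ)) →
    (haveI : Fact (Nat.Prime 3) := ⟨Nat.prime_three⟩; Addv W 3) →
    Nat.card {Q : (W.baseChange ℚ_[3]).toAffine.Point // (3 : ℕ) • Q = 0} = 1 →
    ∀ (v₃ : HeightOneSpectrum (𝓞 ℚ)), ((3 : ℕ) : 𝓞 ℚ) ∈ v₃.asIdeal →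
    ∀ (η : (q : HeightOneSpectrum (𝓞 ℚ)) → (ZMod (Ideal.absNorm q.asIdeal))ˣ),
      (∀ q, Subgroup.zpowers (η q) = ⊤) →
    ∀ {N : ℕ} [NeZero N] (P : ModularParametrizationData W N), N = W.conductorNorm ℤ →
      (∀ z ∈ P.L.lattice, ∃ w ∈ periodLattice P.f, z = P.c * w) →
      (3 ∣ (W.baseChange ℚ_[3]).localTamagawaNumber ℤ_[3] ∨ (3 : ℤ) ∣ P.maninConstant) →
        ∃ e : ℕ, KatoKuriharaPortThreeAtWith₂TwoExp W 0 e v₃ η P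

/-- Local notation: **(C1ₜₑ)|_{t≠0} the fine Kato package WITH EXPONENTS on the rows `#E(ℚ₃)[3] ≠ 1`** — the
companion's (C1ₜₑ) with its defect disjunction specialised to the middle disjunct. -/
local notation3 (prettyPrint := false) "FINEKATO₁" =>
  ∀ (W : WeierstrassCurve ℚ) [W.IsElliptic] [W.IsGloballyMinimal]
    [ContinuousSMul ℤ_[3] (W.tateModule 3)] [Module.Free ℤ_[3] (W.tateModule 3)]
    [Module.Finite ℤ_[3] (W.tateModule 3)],
    (∀ m : ℕ, W.HasSurjectiveModNGaloisRep (3 ^ m : ℕ)) →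
    (haveI : Fact (Nat.Prime 3) := ⟨Nat.prime_three⟩; Addv W 3) →
    Nat.card {Q : (W.baseChange ℚ_[3]).toAffine.Point // (3 : ℕ) • Q = 0} ≠ 1 →
    ∀ (v₃ : HeightOneSpectrum (𝓞 ℚ)), ((3 : ℕ) : 𝓞 ℚ) ∈ v₃.asIdeal →
    ∀ {N : ℕ} [NeZero N] (P : ModularParametrizationData W N), N = W.conductorNorm ℤ →
      (∀ z ∈ P.L.lattice, ∃ w ∈ periodLattice P.f, z = P.c * w) →
      ∃ (t e : ℕ) (ι : (n : ℕ) → (CyclotomicField n ℚ →+* ℂ)) (κK : ℝ)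
        (Λ : ∀ (k' : ℕ) (r : Finset (HeightOneSpectrum (𝓞 ℚ))),
          H1 (tateRep W 3) (cycSubgroup 3 k' r) →ₗ[ℤ_[3]] ℚ_[3] ⊗[ℚ] CyclotomicField (cycLevel 3 k' r) ℚ)
        (Λfin : ∀ j : ℕ, galoisCohomology
          ((W.torsionGaloisModule (((3 : ℕ) : ℤ) ^ j * ((3 : ℕ) : ℤ))).toLocal (Sum.inr v₃)) 1 →+
            ZMod (3 ^ (j + 1))),
        κK ≠ 0 ∧ (∃ u : ℚ, (u : ℝ) = κK ∧ padicValRat 3 u = 0) ∧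
        (∀ j : ℕ,
          (∀ c : ZMod (3 ^ (j + 1)), ∃ x ∈ propagatedSelmerStructure W 3 j (Sum.inr v₃), Λfin j x = c) ∧
          (∀ x ∈ propagatedSelmerStructure W 3 j (Sum.inr v₃),
            Λfin j x = 0 ↔ x ∈ W.kummerSelmerStructure (((3 : ℕ) : ℤ) ^ j * ((3 : ℕ) : ℤ)) (Sum.inr v₃))) ∧
        (∀ j : ℕ, RIDER₂⟦W, j, t, e, v₃, Λ, Λfin j⟧) ∧
        ∀ (c d a : ℤ) (A : ℕ), 0 < A → Int.gcd c (6 * 3 * A) = 1 → Int.gcd d (6 * 3 * N) = 1 →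
          ∃ (z : ∀ (k' : ℕ) (r : (cyclotomicLevelsRat 3 (badPlaces c d A N)).Ideals),
                H1 (tateRep W 3) ((cyclotomicLevelsRat 3 (badPlaces c d A N)).level k' r.1))
            (x : ∀ (k' : ℕ) (r : (cyclotomicLevelsRat 3 (badPlaces c d A N)).Ideals),
                CyclotomicField (cycLevel 3 k' r.1) ℚ),
            ZetaBody W 3 P.f ι κK Λ c d a A z x

/-- Local notation: the REGISTERED stub `stub_additiveDefect` of crux 19562 (skeleton text, verbatim). -/
local notation3 (prettyPrint := false) "STUB19562" =>
  ∀ (W₀ : WeierstrassCurve ℚ) [W₀.IsElliptic] [W₀.IsGloballyMinimal],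
    (∀ n : ℕ, W₀.HasSurjectiveModNGaloisRep (3 ^ n : ℕ)) → Finite W₀.sha →
    ∀ {N : ℕ} [NeZero N], N = W₀.conductorNorm ℤ →
    ∀ (D₀ : Literature.NumberTheory.EllipticCurves.ModularForms.ModularParametrizationData W₀ N),
      (∀ z ∈ D₀.L.lattice, ∃ w ∈ Literature.NumberTheory.EllipticCurves.ModularForms.periodLattice D₀.f, z = D₀.c * w) →
      (∀ (W₂ : WeierstrassCurve ℚ) [W₂.IsElliptic]
        (D₂ : Literature.NumberTheory.EllipticCurves.ModularForms.ModularParametrizationData W₂ N),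
        D₂.f = D₀.f → D₀.modularDegree ≤ D₂.modularDegree) →
      (∀ r : ℚ, Literature.NumberTheory.EllipticCurves.ratPlusSymbol D₀.f r ≠ 0 →
        0 ≤ padicValRat 3 (Literature.NumberTheory.EllipticCurves.ratPlusSymbol D₀.f r)) →
      Literature.NumberTheory.EllipticCurves.kuriharaVanishingOrder W₀ 3 D₀.f = 0 →
      (haveI : Fact (Nat.Prime 3) := ⟨Nat.prime_three⟩;
          Literature.NumberTheory.EllipticCurves.Rank1Residual.Addv W₀ 3) →
      (3 ∣ (W₀.baseChange ℚ_[3]).localTamagawaNumber ℤ_[3] ∨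
        Nat.card {Q : (W₀.baseChange ℚ_[3]).toAffine.Point // (3 : ℕ) • Q = 0} ≠ 1 ∨
        (3 : ℤ) ∣ D₀.maninConstant) →
      ∃ d : ℕ, Literature.NumberTheory.EllipticCurves.kuriharaPartialDeepInfty W₀ 3 D₀.f = d ∧
        ((padicValNat 3 (Nat.card (AddCommGroup.primaryComponent W₀.sha 3)) + d : ℕ) : ℕ∞) ≤
          Literature.NumberTheory.EllipticCurves.kuriharaPartial W₀ 3 D₀.f 0

/-- ★ **The registered stub `stub_additiveDefect` of crux 19562 VERBATIM, split by local `3`-torsion.**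
Inputs: PRINTED [S24] Thm. 4.4 (1)(2) (`hS24`/`hS24₂`, for the `t = 0` rows), S24-DEEP ×2 (`hS24d`/`hS24d₂`, for
the `E(ℚ₃)[3] ≠ 0` rows only), GZK, Poitou–Tate, `hPort₂⁰` (PORT₂ at `t = 0` on the `t = 0` defect rows — acc6 gen 0's
binder, = seat acc3's `portTwoExp_rows_of_fineKato hC1₀` from (C1₂) alone) and (C1ₜₑ)|_{t≠0} (the companion's shape,
`∃ t e`).  Per row: `#E(ℚ₃)[3] = 1` ⟹ `hPort₂⁰` ⟶ gen 1's `portEDeep_of_portTwoExp` ⟶ gen 1's PINNED engine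
`deepUpper_datum_of_poitouTate_of_port_e`;
otherwise ⟹ the companion's `deepWitnessFamily_of_zetaBody_addv_of_valueRows` ((C2) by w2-c3's
`certSupply_of_addv`) ⟶ gen 1's deep engine `deepUpper_datum_of_poitouTate_of_port_e_deep` (depth shift `2`).
[cite: Kim2025RefinedTNC, Thm 1.1] [cite: Kim2022StructureSelmer, Thm. 3.13, Rem. 3.8 and §2.2.2]
[cite: Sakamoto2024, Thm. 4.4 (1)(2) (p. 926)] [cite: MilneADT2006, Ch. I, Thm. 4.10]
[cite: Kato2004Asterisque, (8.1.3), §9.4, Thm. 9.7 and Ex. 13.3] [cite: MazurRubin2004, App. A Lemma A.1 and Prop. A.2] -/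
theorem stub_additiveDefect_of_torsionSplit
    (hS24 : Sakamoto2024.kolyvaginSystems_freeRankOne_zmod_three_pow)
    (hS24₂ : Sakamoto2024.kolyvaginSystems_idealOfBasis_eq_fittingIdeal_zmod_three_pow)
    (hS24d : S24Deep.kolyvaginSystems_freeRankOne_zmod_three_pow_deep)
    (hS24d₂ : S24Deep.kolyvaginSystems_idealOfBasis_eq_fittingIdeal_zmod_three_pow_deep)
    (hGZK : rank_eq_analyticRank_of_analyticRank_le_one)
    (hPT : poitouTate_selmerStructure_duality ℚ)
    (hPort₀ : PORT₂ROWS⁰) (hC1₁ : FINEKATO₁) : STUB19562 := by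
  intro W₀ _ _ htow _ N _ hN D₀ hopt _ hint hord hA hdef
  haveI : Fact (Nat.Prime 3) := ⟨Nat.prime_three⟩
  obtain ⟨v₃, η, hv₃, hη⟩ := exists_place_three_and_generators
  by_cases ht : Nat.card {Q : (W₀.baseChange ℚ_[3]).toAffine.Point // (3 : ℕ) • Q = 0} = 1
  · -- `t = 0` defect row (`3 ∣ c₃` or `3 ∣ c_{D₀}`): PORT₂ from (C1₂), pinned engine on PRINTED [S24]
    have hdef' : 3 ∣ (W₀.baseChange ℚ_[3]).localTamagawaNumber ℤ_[3] ∨ (3 : ℤ) ∣ D₀.maninConstant := by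
      rcases hdef with h | h | h
      · exact Or.inl h
      · exact absurd ht h
      · exact Or.inr h
    obtain ⟨e, hPort₂⟩ := hPort₀ W₀ htow hA ht v₃ hv₃ η hη D₀ hN hopt hdef'
    have hsurj : W₀.HasSurjectiveModNGaloisRep ((3 : ℕ) : ℤ) := by simpa using htow 1
    have ht' : Nat.card {Q : (W₀.baseChange ℚ_[3]).toAffine.Point // (3 : ℕ) • Q = 0} = 3 ^ 0 := by
      simpa using ht
    have hfam := portEDeep_of_portTwoExp W₀ 0 e hA hsurj ht' D₀ v₃ hv₃ η hPort₂
    exact deepUpper_datum_of_poitouTate_of_port_e hS24 hS24₂ hGZK hPT W₀ htow D₀ hint hord v₃ hv₃ η hη 0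
      fun k Dk hDk => hfam k Dk (by simpa using hDk)
  · -- `E(ℚ₃)[3] ≠ 0` row: the companion's deep road (depth shift `2`, the row's exponent `t`)
    haveI : ContinuousSMul ℤ_[3] (W₀.tateModule 3) := TateModule.continuousSMul_padicInt
    haveI : Module.Free ℤ_[3] (W₀.tateModule 3) := W₀.module_free_tateModule_holds 3
    haveI : Module.Finite ℤ_[3] (W₀.tateModule 3) := W₀.module_finite_tateModule_holds 3
    have hsurj : W₀.HasSurjectiveModNGaloisRep (3 : ℕ) := by simpa using htow 1
    obtain ⟨c, d, a, A, d', aM, hApos, hcA, hdN, hcdA, hcd, hdd', hAN, haM, hE0, hE, hR0, hR⟩ :=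
      certSupply_of_addv W₀ hsurj hA D₀ hN
    haveI : NeZero A := ⟨hApos.ne'⟩
    obtain ⟨t, e, ι, κK, Λ, Λfin, hκ0, hNorm, hΛ, hfin₂, hz⟩ := hC1₁ W₀ htow hA ht v₃ hv₃ D₀ hN hopt
    obtain ⟨z, x, hbody⟩ := hz c d a A hApos hcA hdN
    have hirr : W₀.HasIrreducibleModPGaloisRep 3 :=
      KimAtThreeKolyvaginPortShared.hasIrreducibleModPGaloisRep_three_of_tower W₀ htow
    exact deepUpper_datum_of_poitouTate_of_port_e_deep hS24d hS24d₂ hGZK hPT W₀ htow D₀ hint hord v₃ hv₃ η hη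
      2 t (deepWitnessFamily_of_zetaBody_addv_of_valueRows W₀ D₀ hN hbody hirr hA hv₃ Λfin hΛ hfin₂ hcdA
        hNorm hκ0 d' hcd hdd' hAN aM haM hE0 hE hR0 hR)

/-- ★ **Crux `DeepUpperAtThreeOffKatoStratum` (19562) BY NAME, torsion-split additive rows**: the skeleton's case
split on `Addv W₀ 3` — NON-additive rows by w2-c5's Wuthrich road (`stub_nonAdditive_of_wuthrich_of_deepInfty_le_tamagawa`:
Wuthrich 2014 Prop. 21, GZK, modularity, (DD) displayed there only), additive-defect rows by
`stub_additiveDefect_of_torsionSplit`.  Displayed: `hW`, `hGZK`, `hmod`, `hDD` (non-additive rows), [S24] ×2,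
S24-DEEP ×2, `hPT`, `hPort₂⁰`, (C1ₜₑ)|_{t≠0}.
[cite: Wuthrich2014, Prop. 21 (p. 399)] [cite: Kim2025RefinedTNC, Thm 1.1]
[cite: Kim2022StructureSelmer, Thm. 3.13, Rem. 3.8, Conj. 1.10 (PDF p. 8)] [cite: Sakamoto2024, Thm. 4.4 (1)(2) (p. 926)] -/
theorem deepUpperAtThreeOffKatoStratum_of_wuthrich_of_torsionSplit
    (hW : Wuthrich2014.sha_dvd_analyticSha)
    (hGZK : rank_eq_analyticRank_of_analyticRank_le_one) (hmod : hasEntireLFunction_rat)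
    (hDD : ∀ (W₀ : WeierstrassCurve ℚ) [W₀.IsElliptic] [W₀.IsGloballyMinimal],
      (∀ n : ℕ, W₀.HasSurjectiveModNGaloisRep (3 ^ n : ℕ)) → Finite W₀.sha →
      ∀ {N : ℕ} [NeZero N], N = W₀.conductorNorm ℤ →
      ∀ (D₀ : ModularParametrizationData W₀ N),
        (∀ z ∈ D₀.L.lattice, ∃ w ∈ periodLattice D₀.f, z = D₀.c * w) →
        (∀ (W₂ : WeierstrassCurve ℚ) [W₂.IsElliptic] (D₂ : ModularParametrizationData W₂ N),
          D₂.f = D₀.f → D₀.modularDegree ≤ D₂.modularDegree) →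
        (∀ r : ℚ, ratPlusSymbol D₀.f r ≠ 0 → 0 ≤ padicValRat 3 (ratPlusSymbol D₀.f r)) →
        kuriharaVanishingOrder W₀ 3 D₀.f = 0 →
        ¬ (haveI : Fact (Nat.Prime 3) := ⟨Nat.prime_three⟩; Addv W₀ 3) →
        kuriharaPartialDeepInfty W₀ 3 D₀.f ≤ ((padicValNat 3 W₀.tamagawaProduct : ℕ) : ℕ∞))
    (hS24 : Sakamoto2024.kolyvaginSystems_freeRankOne_zmod_three_pow)
    (hS24₂ : Sakamoto2024.kolyvaginSystems_idealOfBasis_eq_fittingIdeal_zmod_three_pow)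
    (hS24d : S24Deep.kolyvaginSystems_freeRankOne_zmod_three_pow_deep)
    (hS24d₂ : S24Deep.kolyvaginSystems_idealOfBasis_eq_fittingIdeal_zmod_three_pow_deep)
    (hPT : poitouTate_selmerStructure_duality ℚ)
    (hPort₀ : PORT₂ROWS⁰) (hC1₁ : FINEKATO₁) :
    DeepUpperAtThreeOffKatoStratum := by
  intro W₀ _ _ htow hfin N _ hN D₀ hopt hdeg hint hord hoff
  by_cases hA : (haveI : Fact (Nat.Prime 3) := ⟨Nat.prime_three⟩; Addv W₀ 3)
  · have hdef : 3 ∣ (W₀.baseChange ℚ_[3]).localTamagawaNumber ℤ_[3] ∨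
        Nat.card {Q : (W₀.baseChange ℚ_[3]).toAffine.Point // (3 : ℕ) • Q = 0} ≠ 1 ∨
        (3 : ℤ) ∣ D₀.maninConstant := by
      by_contra hcon
      push Not at hcon
      exact hoff ⟨hA, hcon.1, hcon.2.1, hcon.2.2⟩
    exact stub_additiveDefect_of_torsionSplit hS24 hS24₂ hS24d hS24d₂ hGZK hPT hPort₀ hC1₁ W₀ htow hfin hN D₀ hopt
      hdeg hint hord hA hdef
  · exact stub_nonAdditive_of_wuthrich_of_deepInfty_le_tamagawa hW hGZK hmod W₀ htow hfin hN D₀ hopt hdeg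
      hint hord hA (hDD W₀ htow hfin hN D₀ hopt hdeg hint hord hA)

end Summit.BirchSwinnertonDyer.BirchSwinnertonDyer.Theorems.KimAtThreeDeepUpperAdditiveDefectTorsionSplit

end
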